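import Mathlib
import HarnessLib
import Summits.HubbardSuperconductivity.HubbardSuperconductivity.Theorems.KLProgrammeKLRegimeWickCrossContractionSum

/-!
# Route `KLProgramme` — ENGINE child (stmt-HubbardSuperconductivity-19918), `stub_engine_step_values` (E2-v9), E2-WICK-ROADMAP §5 (iv):
# the `k + 1`-line two-vertex term — TREE VOCABULARY (row/column sums, entry bounds, sector-overlap support)

Cell gate-hubbard-kl, seat p5 (g4).  Sequel of …WickCrossContractionSum (`sum_norm_kernel_crossContract_le(_of_eq_one)`: the glued FKT Part 3
Prop. XII «three contractions» bound on the tree's Grassmann carriers, with abstract line data `c, d_i, D_i, r_i`).  In the single-scale step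
every line is a pulled-back covariance `C′ = S(Ft)ᵀ·C·S(Ft)` on `SpaceTimeIdx × SectorLeg` (as in
`SectorisedEffectiveActionBound.hubbardSectorKernelNorm_effAction_le_of_sectorNorm`): line `0` is read through the row AND column sums of `‖C′‖`
(`α`, the `α_n` of …SectorSliceAlpha*), lines `i ≥ 1` through an entry bound `‖C′_i(X,Y)‖ ≤ δ_i` (…SectorSliceGram*: `κ_n²`) and the support
property `C′_i(X,Y) ≠ 0 → ovl σ_X σ_Y` for a symmetric overlap relation with at most `ρ` partners per sector (fat sectors: neighbours only).
Then `c = α`, `d_i = δ_i`, `D_i = 𝟙[ovl]`, `r_i = ρ`: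

* `norm_contr_le_indicator_of_support`, `sum_indicator_le_of_card_le(')` — the translation of the hypotheses;
* **`sum_norm_kernel_crossContract_le_of_overlap`** / **`…_of_eq_one`** — `Σ_{Z : Z p = z} ‖kernel ((Δ_×(C_k)∘⋯∘Δ_×(C_0))(a⁰·b¹)) m (Z,s)‖ ≤
  ((k+1+m₀)!(k+1+m₁)!/m!) · (α · ∏_i (δ_i ρ) · Na · Nb)`;
* `crossLaplacian_pow_eq_listProd`, **`sum_norm_kernel_crossLaplacian_pow_le_of_overlap`** / **`…_of_eq_one`** — one covariance on all lines,
  `(Δ_×(C))^{k+1}(a⁰·b¹)` (the order-`k+1` term between two vertices of the single-scale step): `≤ ((k+1+m₀)!(k+1+m₁)!/m!) · (α · (δρ)^k · Na · Nb)`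
  — relative to the one-line term (`k = 0`: `α·Na·Nb`) every further line costs the SUP norm `δ` times `ρ` sector partners instead of a second
  `L¹` norm: the sector-counting gain of FKT Prop. XII / BGM (2.80)–(2.83).

Pure bookkeeping; no definitions, no named facts, nothing about the model.  References (locators only): Feldman–Knörrer–Trubowitz, Rev. Math. Phys.
15 (2003) 1121–1169, Prop. XII; Benfatto–Giuliani–Mastropietro, Ann. Henri Poincaré 7 (2006) §2.8.
-/

noncomputable section

namespace Summit.HubbardSuperconductivity.HubbardSuperconductivity.Theorems.KLRegimeWick

set_option linter.dupNamespace false -- summit = problem name (single-conjunct summit), D-0017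

open Literature.MathematicalPhysics.QuantumLattice GrassmannAlgebra Finset Matrix

section Overlap

variable {𝕜 : Type*} [RCLike 𝕜] {P S : Type*} [Fintype P] [Fintype S] [DecidableEq P] [DecidableEq S]

omit [Fintype P] [Fintype S] [DecidableEq P] [DecidableEq S] in
/-- The entry/support hypotheses of a line give the sector-diagonal sup bound of its two-point function:
`‖A_C(X,Y)‖ ≤ δ · 𝟙[ovl σ_X σ_Y]`. -/
theorem norm_contr_le_indicator_of_support (C : Matrix (P × S) (P × S) 𝕜) (ovl : S → S → Prop) [DecidableRel ovl]
    (hovl : ∀ σ τ, ovl σ τ → ovl τ σ) {δ : ℝ} (hδ : 0 ≤ δ) (hent : ∀ X Y, ‖C X Y‖ ≤ δ)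
    (hsupp : ∀ X Y, C X Y ≠ 0 → ovl X.2 Y.2) (X Y : P × S) :
    ‖contr 𝕜 C X Y‖ ≤ δ * (if ovl X.2 Y.2 then (1 : ℝ) else 0) := by
  refine norm_contr_le_of_entry C (fun σ τ => if ovl σ τ then (1 : ℝ) else 0) (fun σ τ => ?_) (fun X Y => ?_) X Y
  · by_cases h : ovl σ τ
    · rw [if_pos h, if_pos (hovl σ τ h)]
    · have h' : ¬ ovl τ σ := fun h' => h (hovl τ σ h')
      rw [if_neg h, if_neg h']
  · by_cases h0 : C X Y = 0
    · rw [h0, norm_zero]; positivity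
    · rw [if_pos (hsupp X Y h0), mul_one]; exact hent X Y

omit [DecidableEq S] in
/-- At most `ρ` overlap partners: `Σ_τ 𝟙[ovl σ τ] ≤ ρ`. -/
theorem sum_indicator_le_of_card_le (ovl : S → S → Prop) [DecidableRel ovl] {ρ : ℕ}
    (hρ : ∀ σ, (univ.filter fun τ => ovl σ τ).card ≤ ρ) (σ : S) : ∑ τ, (if ovl σ τ then (1 : ℝ) else 0) ≤ ρ := by
  rw [Finset.sum_boole]
  exact_mod_cast hρ σ

omit [DecidableEq S] in
/-- The same count transposed (symmetric relation): `Σ_σ 𝟙[ovl σ τ] ≤ ρ`. -/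
theorem sum_indicator_le_of_card_le' (ovl : S → S → Prop) [DecidableRel ovl] (hovl : ∀ σ τ, ovl σ τ → ovl τ σ) {ρ : ℕ}
    (hρ : ∀ σ, (univ.filter fun τ => ovl σ τ).card ≤ ρ) (τ : S) : ∑ σ, (if ovl σ τ then (1 : ℝ) else 0) ≤ ρ := by
  have h : ∀ σ, (if ovl σ τ then (1 : ℝ) else 0) = if ovl τ σ then (1 : ℝ) else 0 := fun σ => by
    by_cases h : ovl σ τ
    · rw [if_pos h, if_pos (hovl σ τ h)]
    · have h' : ¬ ovl τ σ := fun h' => h (hovl τ σ h')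
      rw [if_neg h, if_neg h']
  simp_rw [h]
  exact sum_indicator_le_of_card_le ovl hρ τ

/-- **The `k + 1`-line two-vertex term, tree vocabulary, pinned at a free leg of `a`.**  Line `0` with row and column sums of `‖C_0‖` at most
`α`; lines `i ≥ 1` with entries `‖C_i(X,Y)‖ ≤ δ_i` supported on overlapping sectors (`ovl` symmetric, at most `ρ` partners); `a`, `b`, `s`, `p`
as in `sum_norm_kernel_crossContract_le`.  Bound: `((k+1+m₀)!(k+1+m₁)!/m!) · (α · ∏_i (δ_i ρ) · Na · Nb)`. -/
theorem sum_norm_kernel_crossContract_le_of_overlap {k m m₀ m₁ : ℕ} (C : Fin (k + 1) → Matrix (P × S) (P × S) 𝕜)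
    (a b : GrassmannAlgebra 𝕜 (P × S)) (s : Fin m → Fin 2) (hm₀ : (univ.filter fun i => s i = 0).card = m₀)
    (hm₁ : (univ.filter fun i => s i = 1).card = m₁) (p : Fin m) (hp : s p = 0) (z : P × S)
    {α : ℝ} (hrow : ∀ X, ∑ Y, ‖C 0 X Y‖ ≤ α) (hcol : ∀ Y, ∑ X, ‖C 0 X Y‖ ≤ α)
    (ovl : S → S → Prop) [DecidableRel ovl] (hovl : ∀ σ τ, ovl σ τ → ovl τ σ) {ρ : ℕ}
    (hρ : ∀ σ, (univ.filter fun τ => ovl σ τ).card ≤ ρ)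
    (δ : Fin k → ℝ) (hδ : ∀ i, 0 ≤ δ i) (hent : ∀ (i : Fin k) (X Y : P × S), ‖C i.succ X Y‖ ≤ δ i)
    (hsupp : ∀ (i : Fin k) (X Y : P × S), C i.succ X Y ≠ 0 → ovl X.2 Y.2)
    {Na Nb : ℝ} (hNb0 : 0 ≤ Nb)
    (hNa : ∀ p₀ : Fin m₀, ∑ X : Fin (k + 1) → P × S, ∑ X₀ ∈ univ.filter (fun X₀ : Fin m₀ → P × S => X₀ p₀ = z),
      ‖kernel 𝕜 a (k + 1 + m₀) (Fin.append X X₀)‖ ≤ Na)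
    (hNb : ∀ (Y₀ : P × S) (τ : Fin k → S), ∑ y : Fin k → P, ∑ Y₁ : Fin m₁ → P × S,
      ‖kernel 𝕜 b (k + 1 + m₁) (Fin.append (Fin.cons Y₀ (fun i => (y i, τ i)) : Fin (k + 1) → P × S) Y₁)‖ ≤ Nb) :
    ∑ Z ∈ univ.filter (fun Z : Fin m → P × S => Z p = z),
        ‖kernel 𝕜 (((List.ofFn fun i => grassmannLaplacian 𝕜 (crossCov 𝕜 (C i))).reverse).prod
          (dblCopy 𝕜 0 a * dblCopy 𝕜 1 b)) m (fun i => (Z i, s i))‖ ≤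
      (((k + 1 + m₀).factorial * (k + 1 + m₁).factorial : ℝ) / m.factorial) * (α * (∏ i, δ i * (ρ : ℝ)) * Na * Nb) :=
  sum_norm_kernel_crossContract_le C a b s hm₀ hm₁ p hp z (sum_norm_contr_le (C 0) hrow hcol)
    (fun _ σ τ => if ovl σ τ then (1 : ℝ) else 0) (fun _ σ τ => by positivity) δ (fun _ => (ρ : ℝ)) hδ
    (fun i X Y => norm_contr_le_indicator_of_support (C i.succ) ovl hovl (hδ i) (hent i) (hsupp i) X Y)
    (fun _ σ => sum_indicator_le_of_card_le ovl hρ σ) hNb0 hNa hNb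

/-- **The same, pinned at a free leg of `b`.** -/
theorem sum_norm_kernel_crossContract_le_of_overlap_of_eq_one {k m m₀ m₁ : ℕ} (C : Fin (k + 1) → Matrix (P × S) (P × S) 𝕜)
    (a b : GrassmannAlgebra 𝕜 (P × S)) (s : Fin m → Fin 2) (hm₀ : (univ.filter fun i => s i = 0).card = m₀)
    (hm₁ : (univ.filter fun i => s i = 1).card = m₁) (p : Fin m) (hp : s p = 1) (z : P × S)
    {α : ℝ} (hrow : ∀ X, ∑ Y, ‖C 0 X Y‖ ≤ α) (hcol : ∀ Y, ∑ X, ‖C 0 X Y‖ ≤ α)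
    (ovl : S → S → Prop) [DecidableRel ovl] (hovl : ∀ σ τ, ovl σ τ → ovl τ σ) {ρ : ℕ}
    (hρ : ∀ σ, (univ.filter fun τ => ovl σ τ).card ≤ ρ)
    (δ : Fin k → ℝ) (hδ : ∀ i, 0 ≤ δ i) (hent : ∀ (i : Fin k) (X Y : P × S), ‖C i.succ X Y‖ ≤ δ i)
    (hsupp : ∀ (i : Fin k) (X Y : P × S), C i.succ X Y ≠ 0 → ovl X.2 Y.2)
    {Na Nb : ℝ} (hNa0 : 0 ≤ Na)
    (hNa : ∀ (X₀ : P × S) (σ : Fin k → S), ∑ x : Fin k → P, ∑ Z₀ : Fin m₀ → P × S,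
      ‖kernel 𝕜 a (k + 1 + m₀) (Fin.append (Fin.cons X₀ (fun i => (x i, σ i)) : Fin (k + 1) → P × S) Z₀)‖ ≤ Na)
    (hNb : ∀ p₁ : Fin m₁, ∑ Y : Fin (k + 1) → P × S, ∑ Y₁ ∈ univ.filter (fun Y₁ : Fin m₁ → P × S => Y₁ p₁ = z),
      ‖kernel 𝕜 b (k + 1 + m₁) (Fin.append Y Y₁)‖ ≤ Nb) :
    ∑ Z ∈ univ.filter (fun Z : Fin m → P × S => Z p = z),
        ‖kernel 𝕜 (((List.ofFn fun i => grassmannLaplacian 𝕜 (crossCov 𝕜 (C i))).reverse).prod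
          (dblCopy 𝕜 0 a * dblCopy 𝕜 1 b)) m (fun i => (Z i, s i))‖ ≤
      (((k + 1 + m₀).factorial * (k + 1 + m₁).factorial : ℝ) / m.factorial) * (α * (∏ i, δ i * (ρ : ℝ)) * Na * Nb) :=
  sum_norm_kernel_crossContract_le_of_eq_one C a b s hm₀ hm₁ p hp z (sum_norm_contr_le (C 0) hrow hcol)
    (fun _ σ τ => if ovl σ τ then (1 : ℝ) else 0) (fun _ σ τ => by positivity) δ (fun _ => (ρ : ℝ)) hδ
    (fun i X Y => norm_contr_le_indicator_of_support (C i.succ) ovl hovl (hδ i) (hent i) (hsupp i) X Y)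
    (fun _ τ => sum_indicator_le_of_card_le' ovl hovl hρ τ) hNa0 hNa hNb

/-- The iterated cross Laplacian of ONE covariance is the list product of §3 with constant lines: `(Δ_×(C))^n = ∏ (ofFn (fun _ => Δ_×(C))).reverse`. -/
theorem crossLaplacian_pow_eq_listProd {R : Type*} [CommRing R] [Algebra ℚ R] {Γ : Type*} [Fintype Γ] [DecidableEq Γ]
    (C : Matrix Γ Γ R) (n : ℕ) :
    (grassmannLaplacian R (crossCov R C)) ^ n = ((List.ofFn fun _ : Fin n => grassmannLaplacian R (crossCov R C)).reverse).prod := by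
  rw [List.ofFn_const, List.reverse_replicate, List.prod_replicate]

/-- **Single-covariance form** (the `(k+1)`-st power of one cross Laplacian, e.g. the order-`k+1` term of `exp Δ_×(C)` between two vertices in the
single-scale step), pinned at a free leg of `a`: row/column sums of `‖C‖` at most `α`, entries at most `δ` supported on overlapping sectors ⇒
`Σ_{Z : Z p = z} ‖kernel ((Δ_×(C))^{k+1}(a⁰·b¹)) m (Z,s)‖ ≤ ((k+1+m₀)!(k+1+m₁)!/m!) · (α · (δρ)^k · Na · Nb)`. -/
theorem sum_norm_kernel_crossLaplacian_pow_le_of_overlap {k m m₀ m₁ : ℕ} (C : Matrix (P × S) (P × S) 𝕜)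
    (a b : GrassmannAlgebra 𝕜 (P × S)) (s : Fin m → Fin 2) (hm₀ : (univ.filter fun i => s i = 0).card = m₀)
    (hm₁ : (univ.filter fun i => s i = 1).card = m₁) (p : Fin m) (hp : s p = 0) (z : P × S)
    {α : ℝ} (hrow : ∀ X, ∑ Y, ‖C X Y‖ ≤ α) (hcol : ∀ Y, ∑ X, ‖C X Y‖ ≤ α)
    (ovl : S → S → Prop) [DecidableRel ovl] (hovl : ∀ σ τ, ovl σ τ → ovl τ σ) {ρ : ℕ}
    (hρ : ∀ σ, (univ.filter fun τ => ovl σ τ).card ≤ ρ)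
    {δ : ℝ} (hδ : 0 ≤ δ) (hent : ∀ X Y, ‖C X Y‖ ≤ δ) (hsupp : ∀ X Y, C X Y ≠ 0 → ovl X.2 Y.2)
    {Na Nb : ℝ} (hNb0 : 0 ≤ Nb)
    (hNa : ∀ p₀ : Fin m₀, ∑ X : Fin (k + 1) → P × S, ∑ X₀ ∈ univ.filter (fun X₀ : Fin m₀ → P × S => X₀ p₀ = z),
      ‖kernel 𝕜 a (k + 1 + m₀) (Fin.append X X₀)‖ ≤ Na)
    (hNb : ∀ (Y₀ : P × S) (τ : Fin k → S), ∑ y : Fin k → P, ∑ Y₁ : Fin m₁ → P × S,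
      ‖kernel 𝕜 b (k + 1 + m₁) (Fin.append (Fin.cons Y₀ (fun i => (y i, τ i)) : Fin (k + 1) → P × S) Y₁)‖ ≤ Nb) :
    ∑ Z ∈ univ.filter (fun Z : Fin m → P × S => Z p = z),
        ‖kernel 𝕜 (((grassmannLaplacian 𝕜 (crossCov 𝕜 C)) ^ (k + 1)) (dblCopy 𝕜 0 a * dblCopy 𝕜 1 b)) m (fun i => (Z i, s i))‖ ≤
      (((k + 1 + m₀).factorial * (k + 1 + m₁).factorial : ℝ) / m.factorial) * (α * (δ * ρ) ^ k * Na * Nb) := by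
  have h := sum_norm_kernel_crossContract_le_of_overlap (fun _ : Fin (k + 1) => C) a b s hm₀ hm₁ p hp z hrow hcol ovl hovl hρ
    (fun _ => δ) (fun _ => hδ) (fun _ => hent) (fun _ => hsupp) hNb0 hNa hNb
  rw [prod_const, card_univ, Fintype.card_fin] at h
  rwa [crossLaplacian_pow_eq_listProd]

/-- **Single-covariance form, pinned at a free leg of `b`.** -/
theorem sum_norm_kernel_crossLaplacian_pow_le_of_overlap_of_eq_one {k m m₀ m₁ : ℕ} (C : Matrix (P × S) (P × S) 𝕜)
    (a b : GrassmannAlgebra 𝕜 (P × S)) (s : Fin m → Fin 2) (hm₀ : (univ.filter fun i => s i = 0).card = m₀)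
    (hm₁ : (univ.filter fun i => s i = 1).card = m₁) (p : Fin m) (hp : s p = 1) (z : P × S)
    {α : ℝ} (hrow : ∀ X, ∑ Y, ‖C X Y‖ ≤ α) (hcol : ∀ Y, ∑ X, ‖C X Y‖ ≤ α)
    (ovl : S → S → Prop) [DecidableRel ovl] (hovl : ∀ σ τ, ovl σ τ → ovl τ σ) {ρ : ℕ}
    (hρ : ∀ σ, (univ.filter fun τ => ovl σ τ).card ≤ ρ)
    {δ : ℝ} (hδ : 0 ≤ δ) (hent : ∀ X Y, ‖C X Y‖ ≤ δ) (hsupp : ∀ X Y, C X Y ≠ 0 → ovl X.2 Y.2)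
    {Na Nb : ℝ} (hNa0 : 0 ≤ Na)
    (hNa : ∀ (X₀ : P × S) (σ : Fin k → S), ∑ x : Fin k → P, ∑ Z₀ : Fin m₀ → P × S,
      ‖kernel 𝕜 a (k + 1 + m₀) (Fin.append (Fin.cons X₀ (fun i => (x i, σ i)) : Fin (k + 1) → P × S) Z₀)‖ ≤ Na)
    (hNb : ∀ p₁ : Fin m₁, ∑ Y : Fin (k + 1) → P × S, ∑ Y₁ ∈ univ.filter (fun Y₁ : Fin m₁ → P × S => Y₁ p₁ = z),
      ‖kernel 𝕜 b (k + 1 + m₁) (Fin.append Y Y₁)‖ ≤ Nb) :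
    ∑ Z ∈ univ.filter (fun Z : Fin m → P × S => Z p = z),
        ‖kernel 𝕜 (((grassmannLaplacian 𝕜 (crossCov 𝕜 C)) ^ (k + 1)) (dblCopy 𝕜 0 a * dblCopy 𝕜 1 b)) m (fun i => (Z i, s i))‖ ≤
      (((k + 1 + m₀).factorial * (k + 1 + m₁).factorial : ℝ) / m.factorial) * (α * (δ * ρ) ^ k * Na * Nb) := by
  have h := sum_norm_kernel_crossContract_le_of_overlap_of_eq_one (fun _ : Fin (k + 1) => C) a b s hm₀ hm₁ p hp z hrow hcol ovl
    hovl hρ (fun _ => δ) (fun _ => hδ) (fun _ => hent) (fun _ => hsupp) hNa0 hNa hNb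
  rw [prod_const, card_univ, Fintype.card_fin] at h
  rwa [crossLaplacian_pow_eq_listProd]

end Overlap

end Summit.HubbardSuperconductivity.HubbardSuperconductivity.Theorems.KLRegimeWick
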